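import Summits.MatrixMultiplication.MatrixMultiplication.Theorems.AbelianSTPPCensusShapeCertVQFinalE
import Summits.MatrixMultiplication.MatrixMultiplication.Theorems.AbelianSTPPCensusLeafTE359Closed
import Summits.MatrixMultiplication.MatrixMultiplication.Theorems.AbelianSTPPCensusShapeCertVQEvalE360
import Summits.MatrixMultiplication.MatrixMultiplication.Theorems.AbelianSTPPCensusShapeCertVQEvalE365
import Summits.MatrixMultiplication.MatrixMultiplication.Theorems.AbelianSTPPCensusShapeCertVQEvalE369
import Summits.MatrixMultiplication.MatrixMultiplication.Theorems.AbelianSTPPCensusShapeCertVQEvalE373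
import Summits.MatrixMultiplication.MatrixMultiplication.Theorems.AbelianSTPPCensusShapeCertVQEvalE377
import Summits.MatrixMultiplication.MatrixMultiplication.Theorems.AbelianSTPPCensusShapeCertVQEvalE380
import Summits.MatrixMultiplication.MatrixMultiplication.Theorems.AbelianSTPPCensusShapeCertVQEvalE383
import Summits.MatrixMultiplication.MatrixMultiplication.Theorems.AbelianSTPPCensusShapeCertVQEvalE386
import Summits.MatrixMultiplication.MatrixMultiplication.Theorems.AbelianSTPPCensusShapeCertVQEvalE389
import Summits.MatrixMultiplication.MatrixMultiplication.Theorems.AbelianSTPPCensusShapeCertVQEvalE392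
import Summits.MatrixMultiplication.MatrixMultiplication.Theorems.AbelianSTPPCensusShapeCertVQEvalE395
import Summits.MatrixMultiplication.MatrixMultiplication.Theorems.AbelianSTPPCensusShapeCertVQEvalE398
import Summits.MatrixMultiplication.MatrixMultiplication.Theorems.AbelianSTPPCensusShapeCertVQEvalE401

/-!
# Rung leaf F-M1.T_E beyond the vP wall — no abelian STPP host of order ≤ 402 beats exponent 5/2

Cell mm-stpp, rung F-M1; successor kernel item VQ-CERT (HOME/mm-stpp-eng-2/energy3/VQ-CERT-SPEC.md) filed in support of the closed
crux item stmt-MatrixMultiplication-19191; seat mm-stpp-vp-p2 (gen 1).  Extends `noAbelianSTPPHostUpTo_250_359` (`…LeafTE359Closed`)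
by the orders `360 ≤ M ≤ 402` with the BUDGETED checker `ShapeCertVQ.checkQE` (`…ShapeCertVQDefsE`: the vQ search with the E3⁺
continuation budget; soundness `…ShapeCertVQBudgetE.AboveQ.tail_uu_le_qE`, `…ShapeCertVQSearchE.checkQE_sound`, bridge
`…ShapeCertVQFinalE`), kernel-evaluated in `…ShapeCertVQEvalE360 … E401` (one `decide +kernel` per order, root segments at `401–402`
assembled here; standard axioms, no `native_decide`).  Hence `shapeExclusionVQ_338_402` and the named leaf
**`noAbelianSTPPHostUpTo_250_402 : NoAbelianSTPPHostUpTo (5/2) 402`**.  (The orders `403+` follow in a later leaf once their path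
segments land.)
WHAT THIS IS NOT: no bound on `ω`; a rung leaf (finite range of a necessary condition), never summit credit; no existence claim;
nothing about orders `≥ 403`.
-/

set_option linter.dupNamespace false -- `MatrixMultiplication.MatrixMultiplication` (summit = problem, D-0017)
set_option autoImplicit false

namespace Summit.MatrixMultiplication.MatrixMultiplication.Theorems

open Finset STPPThreeRoomEnergy

/-- budgeted vQ certificate check at order `401`, assembled from its 2 root segments. -/
theorem ShapeCertVQ.checkQE_401 : ShapeCertVQ.checkQE 401 = true :=
  ShapeCertVQ.checkQE_of_root <| ShapeCertVQ.rootSegQE_append ShapeCertVQ.rootSegQE_401_0 <|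
    ShapeCertVQ.rootSegQE_append ShapeCertVQ.rootSegQE_401_99 <|
    ShapeCertVQ.rootTailE_nil' (by norm_num)

/-- budgeted vQ certificate check at order `402`, assembled from its 3 root segments. -/
theorem ShapeCertVQ.checkQE_402 : ShapeCertVQ.checkQE 402 = true :=
  ShapeCertVQ.checkQE_of_root <| ShapeCertVQ.rootSegQE_append ShapeCertVQ.rootSegQE_402_0 <|
    ShapeCertVQ.rootSegQE_append ShapeCertVQ.rootSegQE_402_95 <|
    ShapeCertVQ.rootSegQE_append ShapeCertVQ.rootSegQE_402_5113 <|
    ShapeCertVQ.rootTailE_nil' (by norm_num)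

/-- **The budgeted vQ certificate holds at every order `360 ≤ M ≤ 402`.** -/
theorem ShapeCertVQ.checkQE_360_402 (M : ℕ) (h₁ : 360 ≤ M) (h₂ : M ≤ 402) : ShapeCertVQ.checkQE M = true := by
  interval_cases M
  · exact ShapeCertVQ.checkQE_360
  · exact ShapeCertVQ.checkQE_361
  · exact ShapeCertVQ.checkQE_362
  · exact ShapeCertVQ.checkQE_363
  · exact ShapeCertVQ.checkQE_364
  · exact ShapeCertVQ.checkQE_365
  · exact ShapeCertVQ.checkQE_366
  · exact ShapeCertVQ.checkQE_367
  · exact ShapeCertVQ.checkQE_368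
  · exact ShapeCertVQ.checkQE_369
  · exact ShapeCertVQ.checkQE_370
  · exact ShapeCertVQ.checkQE_371
  · exact ShapeCertVQ.checkQE_372
  · exact ShapeCertVQ.checkQE_373
  · exact ShapeCertVQ.checkQE_374
  · exact ShapeCertVQ.checkQE_375
  · exact ShapeCertVQ.checkQE_376
  · exact ShapeCertVQ.checkQE_377
  · exact ShapeCertVQ.checkQE_378
  · exact ShapeCertVQ.checkQE_379
  · exact ShapeCertVQ.checkQE_380
  · exact ShapeCertVQ.checkQE_381
  · exact ShapeCertVQ.checkQE_382
  · exact ShapeCertVQ.checkQE_383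
  · exact ShapeCertVQ.checkQE_384
  · exact ShapeCertVQ.checkQE_385
  · exact ShapeCertVQ.checkQE_386
  · exact ShapeCertVQ.checkQE_387
  · exact ShapeCertVQ.checkQE_388
  · exact ShapeCertVQ.checkQE_389
  · exact ShapeCertVQ.checkQE_390
  · exact ShapeCertVQ.checkQE_391
  · exact ShapeCertVQ.checkQE_392
  · exact ShapeCertVQ.checkQE_393
  · exact ShapeCertVQ.checkQE_394
  · exact ShapeCertVQ.checkQE_395
  · exact ShapeCertVQ.checkQE_396
  · exact ShapeCertVQ.checkQE_397
  · exact ShapeCertVQ.checkQE_398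
  · exact ShapeCertVQ.checkQE_399
  · exact ShapeCertVQ.checkQE_400
  · exact ShapeCertVQ.checkQE_401
  · exact ShapeCertVQ.checkQE_402

/-- **vQ shape exclusion for `T_E` (`τ = 5/2`) at the orders `338 ≤ M ≤ 402`**: no shape list with at least two members that
satisfies the vP sieve system and the E3⁺ condition beats `5/2`. [original] -/
theorem shapeExclusionVQ_338_402 : ∀ (N M : ℕ) (a b c : Fin N → ℕ), 2 ≤ N → 338 ≤ M → M ≤ 402 →
    SieveAdmissibleVP M a b c → E3pAdm M a b c → ¬ Beats (5 / 2) M a b c := by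
  intro N M a b c hN h₁ h₂
  rcases Nat.lt_or_ge M 360 with k | g
  · exact shapeExclusionVQ_338_359 N M a b c hN h₁ (by omega)
  · exact ShapeCertVQ.shapeExclusionVQ_of_checkQE (by omega) (ShapeCertVQ.checkQE_360_402 M g h₂) N a b c hN

/-- **Rung leaf T_E/402 (closed, beyond the vP wall).** No finite abelian group of order at most `402` hosts an STPP family
beating exponent `5/2`: `Σ_i (|A_i||B_i||C_i|)^{5/6} ≤ |H|` for every STPP family in every such `H`. [original] -/
theorem noAbelianSTPPHostUpTo_250_402 : NoAbelianSTPPHostUpTo (5 / 2) 402 := by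
  classical
  refine AbelianTECensus.noAbelianSTPPHostUpTo_of_two (τ := 5 / 2) (by norm_num) (by norm_num) ?_
  intro H _ _ hM N A B C hS hne hN
  by_cases h337 : Fintype.card H ≤ 337
  · exact noAbelianSTPPHost_250_337 H h337 N A B C hS
  · have hadm : SieveAdmissibleVP (Fintype.card H) (fun i => (A i).card) (fun i => (B i).card) (fun i => (C i).card) :=
      ⟨AbelianTECensus.sieveSound H N A B C hS hne, u11GSound_holds H N A B C hS hne,
        fun hp => STPPRepCount.u11PSound H hp N A B C hS hne⟩
    have hE : E3pAdm (Fintype.card H) (fun i => (A i).card) (fun i => (B i).card) (fun i => (C i).card) :=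
      e3pAdm_of_isSTPP hS hne
    have h := shapeExclusionVQ_338_402 N (Fintype.card H) _ _ _ hN (by omega) hM hadm hE
    unfold Beats at h
    push Not at h
    simpa [shapeVol] using h

end Summit.MatrixMultiplication.MatrixMultiplication.Theorems
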